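import Mathlib
import Literature.Topology.FourManifolds.PlanarAchiralWords
import HarnessLib

/-!
# The model planar page `P_n` (disc with `n` round holes), its arcs, lassos, and the semantics of
# arc data ("`φ` is realised by the homeomorphism `f`")

Topic `Literature/Topology/FourManifolds` (general mathematics; definitions and elementary lemmas,
nothing asserted).  First brick (D0 of the vocabulary programme G3 recorded in
`Summits/SmoothPoincare4/SmoothPoincare4/Cruxes/PlanarAcyclicBisectionRigidity/DictionaryDesign.md`)
under the registered combinatorial model `Literature.Topology.FourManifolds.PlanarWords.ArcData` of
`Mod(D_n, ∂)` (`PlanarAchiralWords.lean`): it gives that model its MEANING, so that the cite facts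
of the dictionary (Wendl 2010 Thm 1; Gompf–Stipsicz §8.2; Loi–Piergallini 2001; the Alexander
method, Farb–Margalit Prop. 2.8) can later be STATED over planar open books and planar Lefschetz
fibrations.

## Content

* `PlanarPage.holeRadius n = 1/(4(n+1))`, `PlanarPage.holeCentre n j = (2(j+1) − (n+1))/(n+1)` — the
  `n` holes sit on the real axis, left to right, evenly spaced in `(−1, 1)`;
  `PlanarPage.pageSet n = {z ∈ ℂ | ‖z‖ ≤ 1, ∀ j, holeRadius ≤ ‖z − holeCentre j‖}` and the compact
  subtype `PlanarPage n` (Farb–Margalit's `D_n`; for `n = 0` the closed disc);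
* marked points and boundary parametrisations: `outerPt n s = i·e^{2πis}` (counterclockwise = the
  boundary orientation of the outer circle), `innerPt n j s = c_j + ρ i e^{−2πis}` (clockwise = the
  boundary orientation of the hole), `basePoint n = outerPt n 0 = i`, `holeTop n j = innerPt n j 0`,
  `bdryPt n : Option (Fin n) → ℝ → PlanarPage n` (`none` = outer circle);
* `arc n j : Path (basePoint n) (holeTop n j)` — the straight segment `δ_j` from `i` down to the top
  of hole `j` (it stays at height `≥ ρ`, so off every hole); `holeLoop n j` — the counterclockwise
  circuit of the `j`-th hole boundary from its top; `lasso n j = δ_j · ∂_j · δ_j⁻¹ : Path p₀ p₀`,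
  the free generator `x_j` of `π₁(P_n, p₀)`;
* `wordClass n w : Path.Homotopic.Quotient p₀ p₀` — the loop class spelled by a word `w ∈ F_n` in the
  lassos (`wordClass_of`, `wordClass_mul`, `wordClass_one`, `wordClass_inv`), through
  `loopClass n : F_n →* π₁(P_n, p₀)ᵐᵒᵖ` (Mathlib's `FundamentalGroup` multiplies in the order
  "`p * q` = first `q` then `p`", `FundamentalGroup.mul_def`, hence the opposite group);
* `IsRealisedBy n φ f` — THE SEMANTICS OF ARC DATA: the homeomorphism `f` of the page fixes the outer
  circle pointwise, carries the boundary of hole `j` to the boundary of hole `π j` WITHOUT ROTATION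
  (`f (innerPt j s) = innerPt (π j) s`), and carries the arc `δ_j` to a path homotopic (rel end
  points) to `u_j · δ_{π j}` — Farb–Margalit's description of a mapping class by its action on a
  filling arc system (the Alexander method, Prop. 2.8), in the coordinates of `ArcData`
  (`φ(δᵢ) ≃ uᵢ · δ_{π i}`).

## What is NOT here (design; see DictionaryDesign.md §4)

No statement that arc data are FAITHFUL or COMPOSABLE (`IsRealisedBy n φ f → IsRealisedBy n ψ g →
IsRealisedBy n (φ.mul ψ) (g.trans f)`; Alexander method `… → f ≃ g rel ∂`; `wordClass` injective):
those are the cite facts F0 of the programme, filed separately.  No smooth structure on the page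
(the dictionary reads pages topologically and puts smoothness in the 4-dimensional bodies), no open
books (D-a), no Lefschetz bodies (D-b).

## References
* B. Farb, D. Margalit, *A Primer on Mapping Class Groups*, Princeton Math. Ser. 49 (2012), §1.3
  (the disc `D_n`, the free basis of `π₁`), §2.3 Prop. 2.8 (Alexander method). [FarbMargalit2012]
* R. E. Gompf, A. I. Stipsicz, *4-Manifolds and Kirby Calculus* (1999), §8.2. [GompfStipsiczGSM1999]
-/

noncomputable section

open Complex Set Function
open scoped Real _root_.Topology

namespace Literature.Topology.FourManifolds

open Literature.Topology.FourManifolds.PlanarWords (ArcData)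

namespace PlanarPage

/-- The common radius `ρ = 1/(4(n+1))` of the `n` round holes of the model page. [folklore] -/
def holeRadius (n : ℕ) : ℝ := 1 / (4 * (n + 1))

/-- The centre `c_j = (2(j+1) − (n+1))/(n+1) ∈ (−1, 1)` of the `j`-th hole (on the real axis, left
to right). [folklore] -/
def holeCentre (n : ℕ) (j : Fin n) : ℝ := (2 * ((j : ℕ) + 1 : ℝ) - (n + 1)) / (n + 1)

/-- The model PAGE as a subset of `ℂ`: the closed unit disc minus the `n` open round holes.
[cite: FarbMargalit2012, §1.3] -/
def pageSet (n : ℕ) : Set ℂ :=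
  {z | ‖z‖ ≤ 1 ∧ ∀ j : Fin n, holeRadius n ≤ ‖z - holeCentre n j‖}

variable {n : ℕ}

/-- `ρ > 0`. [folklore] -/
theorem holeRadius_pos (n : ℕ) : 0 < holeRadius n := by
  unfold holeRadius; positivity

/-- `2ρ ≤ 2/(n+1)` in the useful form `ρ ≤ 2/(n+1) − ρ`. [folklore] -/
theorem holeRadius_le_two_div_sub (n : ℕ) : holeRadius n ≤ 2 / (n + 1) - holeRadius n := by
  unfold holeRadius
  have hn : (0 : ℝ) < n + 1 := by positivity
  rw [div_sub_div _ _ hn.ne' (by positivity), le_div_iff₀ (by positivity), div_mul_eq_mul_div,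
    div_le_iff₀ (by positivity)]
  nlinarith

/-- `ρ ≤ 2/(n+1)`. [folklore] -/
theorem holeRadius_le_two_div (n : ℕ) : holeRadius n ≤ 2 / (n + 1) :=
  (holeRadius_le_two_div_sub n).trans (sub_le_self _ (holeRadius_pos n).le)

/-- `ρ ≤ 1`. [folklore] -/
theorem holeRadius_le_one (n : ℕ) : holeRadius n ≤ 1 := by
  unfold holeRadius
  rw [div_le_one (by positivity)]
  have : (0 : ℝ) ≤ n := n.cast_nonneg
  nlinarith

/-- The hole centres lie in `[−1 + 2/(n+1), 1 − 2/(n+1)]`. [folklore] -/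
theorem abs_holeCentre_le (j : Fin n) : |holeCentre n j| ≤ 1 - 2 / (n + 1) := by
  unfold holeCentre
  have hn : (0 : ℝ) < n + 1 := by positivity
  have hj : ((j : ℕ) : ℝ) + 1 ≤ n := by exact_mod_cast j.is_lt
  have hj0 : (0 : ℝ) ≤ (j : ℕ) := Nat.cast_nonneg _
  rw [abs_div, abs_of_pos hn, div_le_iff₀ hn, sub_mul, div_mul_cancel₀ _ hn.ne', one_mul, abs_le]
  constructor <;> nlinarith

/-- Distinct hole centres are `≥ 2/(n+1)` apart. [folklore] -/
theorem two_div_le_abs_holeCentre_sub {j k : Fin n} (h : j ≠ k) :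
    2 / (n + 1) ≤ |holeCentre n j - holeCentre n k| := by
  unfold holeCentre
  have hn : (0 : ℝ) < n + 1 := by positivity
  rw [← sub_div, abs_div, abs_of_pos hn, div_le_div_iff_of_pos_right hn]
  have hjk : (1 : ℝ) ≤ |((j : ℕ) : ℝ) - ((k : ℕ) : ℝ)| := by
    rcases lt_or_gt_of_ne (Fin.val_ne_of_ne h) with hlt | hlt
    · rw [abs_of_neg (sub_neg.2 (by exact_mod_cast hlt))]
      have : ((j : ℕ) : ℝ) + 1 ≤ (k : ℕ) := by exact_mod_cast hlt
      linarith
    · rw [abs_of_pos (sub_pos.2 (by exact_mod_cast hlt))]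
      have : ((k : ℕ) : ℝ) + 1 ≤ (j : ℕ) := by exact_mod_cast hlt
      linarith
  have : (2 : ℝ) * ((j : ℕ) + 1) - (n + 1) - (2 * ((k : ℕ) + 1) - (n + 1)) = 2 * (((j : ℕ) : ℝ) - (k : ℕ)) := by ring
  rw [this, abs_mul, abs_two]
  linarith

/-- A point of the closed unit disc at height `≥ ρ` above the real axis lies in the page.
[folklore] -/
theorem mem_pageSet_of_im {z : ℂ} (hz : ‖z‖ ≤ 1) (him : holeRadius n ≤ z.im) : z ∈ pageSet n :=
  ⟨hz, fun j => ((le_abs_self _).trans' him).trans (by simpa using abs_im_le_norm (z - holeCentre n j))⟩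

/-- A point of the unit circle lies in the page (the holes stay `2/(n+1) ≥ ρ` away from it).
[folklore] -/
theorem mem_pageSet_of_norm_eq_one {z : ℂ} (hz : ‖z‖ = 1) : z ∈ pageSet n := by
  refine ⟨hz.le, fun j => (holeRadius_le_two_div n).trans ?_⟩
  have h1 := abs_holeCentre_le j
  have h2 : ‖z‖ - ‖(holeCentre n j : ℂ)‖ ≤ ‖z - holeCentre n j‖ := norm_sub_norm_le z _
  rw [hz, norm_real, Real.norm_eq_abs] at h2
  linarith

/-- A point at distance exactly `ρ` from the centre of hole `j` lies in the page. [folklore] -/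
theorem mem_pageSet_of_norm_sub_eq (j : Fin n) {z : ℂ} (hz : ‖z - holeCentre n j‖ = holeRadius n) :
    z ∈ pageSet n := by
  have hc := abs_holeCentre_le j
  have hρ := holeRadius_le_two_div n
  refine ⟨?_, fun k => ?_⟩
  · have : ‖z‖ ≤ ‖z - holeCentre n j‖ + ‖(holeCentre n j : ℂ)‖ := norm_le_norm_sub_add z _
    rw [hz, norm_real, Real.norm_eq_abs] at this
    linarith
  · by_cases hjk : k = j
    · subst hjk; exact hz.ge
    · have hsep := two_div_le_abs_holeCentre_sub hjk
      have h3 : ‖((holeCentre n k : ℂ)) - holeCentre n j‖ - ‖z - holeCentre n j‖ ≤ ‖(holeCentre n k : ℂ) - z‖ := by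
        have := norm_sub_norm_le ((holeCentre n k : ℂ) - holeCentre n j) (z - holeCentre n j)
        rwa [sub_sub_sub_cancel_right] at this
      rw [← ofReal_sub, norm_real, Real.norm_eq_abs, hz, norm_sub_rev] at h3
      linarith [holeRadius_le_two_div_sub n]

/-- The page is closed in `ℂ`. [folklore] -/
theorem isClosed_pageSet (n : ℕ) : IsClosed (pageSet n) := by
  have : pageSet n = {z : ℂ | ‖z‖ ≤ 1} ∩ ⋂ j : Fin n, {z | holeRadius n ≤ ‖z - holeCentre n j‖} := by
    ext z; simp [pageSet]
  rw [this]
  exact (isClosed_le continuous_norm continuous_const).inter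
    (isClosed_iInter fun j => isClosed_le continuous_const (continuous_norm.comp (continuous_sub_right _)))

/-- The page is compact. [folklore] -/
theorem isCompact_pageSet (n : ℕ) : IsCompact (pageSet n) :=
  (ProperSpace.isCompact_closedBall (0 : ℂ) 1).of_isClosed_subset (isClosed_pageSet n)
    fun z hz => by simpa using hz.1

end PlanarPage

/-- **The model planar page `P_n`** — the disc with `n` holes `D_n` of Farb–Margalit, as a compact
subspace of `ℂ`: the closed unit disc minus `n` open round holes of radius `1/(4(n+1))` centred on
the real axis. [cite: FarbMargalit2012, §1.3] -/
abbrev PlanarPage (n : ℕ) : Type := ↥(PlanarPage.pageSet n)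

namespace PlanarPage

variable {n : ℕ}

/-- The model page is compact (a closed subset of the closed unit disc). [folklore] -/
instance instCompactSpace (n : ℕ) : CompactSpace (PlanarPage n) :=
  isCompact_iff_compactSpace.mp (isCompact_pageSet n)

/-- The outer boundary circle, parametrised COUNTERCLOCKWISE (its boundary orientation) from the top
point `i`: `s ↦ i·e^{2πis}`. [folklore] -/
def outerPt (n : ℕ) (s : ℝ) : PlanarPage n :=
  ⟨I * exp (2 * π * s * I), mem_pageSet_of_norm_eq_one (by
    rw [norm_mul, norm_I, one_mul, show (2 * π * s * I : ℂ) = ((2 * π * s : ℝ) : ℂ) * I by push_cast; ring,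
      norm_exp_ofReal_mul_I])⟩

/-- The boundary circle of hole `j`, parametrised CLOCKWISE (its boundary orientation as a boundary
component of the page) from its top point: `s ↦ c_j + ρ·i·e^{−2πis}`. [folklore] -/
def innerPt (n : ℕ) (j : Fin n) (s : ℝ) : PlanarPage n :=
  ⟨holeCentre n j + holeRadius n * (I * exp (-(2 * π * s) * I)), mem_pageSet_of_norm_sub_eq j (by
    rw [add_sub_cancel_left, norm_mul, norm_mul, norm_I, one_mul, norm_real, Real.norm_eq_abs,
      abs_of_pos (holeRadius_pos n),
      show (-(2 * π * s) * I : ℂ) = ((-(2 * π * s) : ℝ) : ℂ) * I by push_cast; ring,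
      norm_exp_ofReal_mul_I, mul_one])⟩

/-- The base point `p₀ = i`, the top of the outer circle. [folklore] -/
def basePoint (n : ℕ) : PlanarPage n := outerPt n 0

/-- The top point `q_j = c_j + ρ i` of the boundary of hole `j`. [folklore] -/
def holeTop (n : ℕ) (j : Fin n) : PlanarPage n := innerPt n j 0

/-- All boundary circles at once: `none` = the outer circle, `some j` = hole `j`, each in its boundary
orientation. [folklore] -/
def bdryPt (n : ℕ) : Option (Fin n) → ℝ → PlanarPage n
  | none => outerPt n
  | some j => innerPt n j

/-- The base point is `i`. [folklore] -/
@[simp] theorem coe_basePoint : ((basePoint n : PlanarPage n) : ℂ) = I := by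
  simp [basePoint, outerPt]

/-- The top of hole `j` is `c_j + ρ i`. [folklore] -/
@[simp] theorem coe_holeTop (j : Fin n) :
    ((holeTop n j : PlanarPage n) : ℂ) = holeCentre n j + holeRadius n * I := by
  simp [holeTop, innerPt]

/-- The outer parametrisation is `1`-periodic. [folklore] -/
theorem outerPt_add_one (s : ℝ) : outerPt n (s + 1) = outerPt n s := by
  apply Subtype.ext
  simp only [outerPt]
  rw [show (2 * π * ((s + 1 : ℝ) : ℂ) * I) = 2 * π * s * I + 2 * π * I by push_cast; ring,
    Complex.exp_add, exp_two_pi_mul_I, mul_one]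

/-- The inner parametrisations are `1`-periodic. [folklore] -/
theorem innerPt_add_one (j : Fin n) (s : ℝ) : innerPt n j (s + 1) = innerPt n j s := by
  apply Subtype.ext
  simp only [innerPt]
  rw [show (-(2 * π * ((s + 1 : ℝ) : ℂ)) * I) = -(2 * π * s) * I + (-1 : ℤ) * (2 * π * I) by push_cast; ring,
    Complex.exp_add, exp_int_mul_two_pi_mul_I, mul_one]

/-- **The arc `δ_j`**: the straight segment from the base point `i` to the top of hole `j`.  It stays
at height `≥ ρ` above the real axis, hence inside the page. [cite: FarbMargalit2012, §1.3] -/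
def arc (n : ℕ) (j : Fin n) : Path (basePoint n) (holeTop n j) where
  toFun t := ⟨(1 - (t : ℝ)) * I + (t : ℝ) * (holeCentre n j + holeRadius n * I), by
    have ht0 : 0 ≤ (t : ℝ) := t.2.1
    have ht1 : (t : ℝ) ≤ 1 := t.2.2
    refine mem_pageSet_of_im ?_ ?_
    · calc ‖(1 - (t : ℝ)) * I + (t : ℝ) * ((holeCentre n j : ℂ) + holeRadius n * I)‖
          ≤ ‖((1 - (t : ℝ) : ℝ) : ℂ) * I‖ + ‖((t : ℝ) : ℂ) * ((holeCentre n j : ℂ) + holeRadius n * I)‖ := by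
            push_cast; exact norm_add_le _ _
        _ = (1 - (t : ℝ)) + (t : ℝ) * ‖(holeCentre n j : ℂ) + holeRadius n * I‖ := by
            rw [norm_mul, norm_mul, norm_I, mul_one, norm_real, norm_real, Real.norm_eq_abs,
              Real.norm_eq_abs, abs_of_nonneg (sub_nonneg.2 ht1), abs_of_nonneg ht0]
        _ ≤ (1 - (t : ℝ)) + (t : ℝ) * 1 := by
            gcongr
            simpa using (holeTop n j).2.1
        _ = 1 := by ring
    · have him : ((1 - (t : ℝ)) * I + (t : ℝ) * ((holeCentre n j : ℂ) + holeRadius n * I)).im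
          = (1 - (t : ℝ)) + (t : ℝ) * holeRadius n := by simp
      rw [him]
      nlinarith [holeRadius_le_one n]⟩
  continuous_toFun := by
    apply Continuous.subtype_mk
    fun_prop
  source' := by apply Subtype.ext; simp
  target' := by apply Subtype.ext; simp

/-- **The boundary circuit `∂_j` of hole `j`, COUNTERCLOCKWISE from its top** (`s ↦ innerPt j (−s)`),
a loop at `holeTop n j`. [folklore] -/
def holeLoop (n : ℕ) (j : Fin n) : Path (holeTop n j) (holeTop n j) where
  toFun t := innerPt n j (-(t : ℝ))
  continuous_toFun := by
    apply Continuous.subtype_mk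
    fun_prop
  source' := by simp [holeTop]
  target' := by
    change innerPt n j (-(1 : ℝ)) = holeTop n j
    rw [holeTop, show (0 : ℝ) = -1 + 1 by norm_num, innerPt_add_one]

/-- **The lasso `x_j = δ_j · ∂_j · δ_j⁻¹`** about hole `j`, a loop at the base point: the `j`-th free
generator of `π₁(P_n, p₀) = F_n`. [cite: FarbMargalit2012, §1.3] -/
def lasso (n : ℕ) (j : Fin n) : Path (basePoint n) (basePoint n) :=
  (arc n j).trans ((holeLoop n j).trans (arc n j).symm)

/-- The lassos as a homomorphism `F_n → π₁(P_n, p₀)ᵐᵒᵖ` (opposite, because Mathlib's fundamental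
group multiplies in the order "`p * q` = first `q`, then `p`", `FundamentalGroup.mul_def`).
[folklore] -/
def loopClass (n : ℕ) : FreeGroup (Fin n) →* (FundamentalGroup (PlanarPage n) (basePoint n))ᵐᵒᵖ :=
  FreeGroup.lift fun j => MulOpposite.op (FundamentalGroup.fromPath ⟦lasso n j⟧)

/-- **The loop class spelled by a word** `w ∈ F_n` in the lassos, as a path-homotopy class at the
base point (first letter traversed first). [folklore] -/
def wordClass (n : ℕ) (w : FreeGroup (Fin n)) : Path.Homotopic.Quotient (basePoint n) (basePoint n) :=
  FundamentalGroup.toPath (MulOpposite.unop (loopClass n w))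

/-- A generator spells its lasso. [folklore] -/
@[simp] theorem wordClass_of (j : Fin n) : wordClass n (FreeGroup.of j) = ⟦lasso n j⟧ := by
  simp [wordClass, loopClass]

/-- The empty word spells the constant loop. [folklore] -/
@[simp] theorem wordClass_one : wordClass n 1 = Path.Homotopic.Quotient.refl (basePoint n) := by
  simp only [wordClass, map_one, MulOpposite.unop_one]
  rfl

/-- Concatenation of words is concatenation of loops (first `w₁`, then `w₂`). [folklore] -/
theorem wordClass_mul (w₁ w₂ : FreeGroup (Fin n)) :
    wordClass n (w₁ * w₂) = (wordClass n w₁).trans (wordClass n w₂) := by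
  simp only [wordClass, map_mul, MulOpposite.unop_mul, FundamentalGroup.mul_def]

/-- The inverse word spells the reversed loop. [folklore] -/
theorem wordClass_inv (w : FreeGroup (Fin n)) : wordClass n w⁻¹ = (wordClass n w).symm := by
  simp only [wordClass, map_inv, MulOpposite.unop_inv, FundamentalGroup.inv_def]

/-- **`φ` IS REALISED BY `f` — the semantics of arc data.**  The homeomorphism `f` of the page
realises the arc datum `φ = (π, u) : ArcData n` when it fixes the outer circle pointwise, carries
the boundary of hole `j` onto the boundary of hole `π j` without rotation (matching the marked
parametrisations), and carries each arc `δ_j` to a path homotopic, relative to its end points, to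
`u_j · δ_{π j}` (the loop spelled by `u_j` followed by the arc to hole `π j`).  By the Alexander
method a mapping class of `(D_n, ∂D_n)` is determined by these data (Farb–Margalit 2012,
Prop. 2.8); that faithfulness, and composability, are cite facts filed separately — this structure
only NAMES the relation. [cite: FarbMargalit2012, Prop. 2.8] -/
structure IsRealisedBy (n : ℕ) (φ : ArcData n) (f : PlanarPage n ≃ₜ PlanarPage n) : Prop where
  /-- `f` fixes the outer boundary circle pointwise -/
  outer : ∀ s, f (outerPt n s) = outerPt n s
  /-- `f` maps the boundary of hole `j` to the boundary of hole `π j`, matching parametrisations -/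
  inner : ∀ j s, f (innerPt n j s) = innerPt n (φ.perm j) s
  /-- `f(δ_j) ≃ u_j · δ_{π j}` relative to the end points -/
  arcs : ∀ j, (Path.Homotopic.Quotient.mk ((arc n j).map f.continuous)).cast (outer 0).symm (inner j 0).symm
    = (wordClass n (φ.u j)).trans ⟦arc n (φ.perm j)⟧

/-- The identity homeomorphism realises the identity arc datum. [folklore] -/
theorem IsRealisedBy.one (n : ℕ) : IsRealisedBy n ArcData.one (Homeomorph.refl (PlanarPage n)) := by
  refine ⟨fun s => rfl, fun j s => rfl, fun j => ?_⟩
  change (Path.Homotopic.Quotient.mk ((arc n j).map (Homeomorph.refl (PlanarPage n)).continuous)).cast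
      rfl rfl = (wordClass n 1).trans ⟦arc n j⟧
  rw [wordClass_one, Path.Homotopic.Quotient.cast_rfl_rfl, ← Path.Homotopic.Quotient.mk_refl]
  change Path.Homotopic.Quotient.mk _ = Path.Homotopic.Quotient.trans (Path.Homotopic.Quotient.mk _)
    (Path.Homotopic.Quotient.mk _)
  rw [← Path.Homotopic.Quotient.mk_trans]
  have hP : (arc n j).map (Homeomorph.refl (PlanarPage n)).continuous = arc n j := by ext; rfl
  rw [hP]
  exact Quotient.sound ⟨(Path.Homotopy.reflTrans (arc n j)).symm⟩

end PlanarPage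

end Literature.Topology.FourManifolds

end
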